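import Literature.Geometry.Kaehler.ComplexTorusCyclotomicAutomorphismOrderEightTwelve
import Literature.Geometry.Kaehler.ComplexTorusCyclotomicAutomorphismSimpleIsomorphismClasses
import Literature.AlgebraicGeometry.ComplexMultiplication.CyclotomicCMTypeCensusSevenNine
import Literature.NumberTheory.ComplexMultiplication.CMTorusInducedTypeProduct
import HarnessLib

/-!
# Complex tori of dimension `3` with an automorphism of order `7`: `(X, u) ≅ (ℂ³/Φ(𝔞), ζ_7)`; `X` is simple iff
# `Φ` is one of the six primitive types, otherwise `X ∼ E × E × E`; for `h(ℚ(ζ_7)) = 1` there are EXACTLY TWO such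
# tori — the simple `ζ_7`-threefold and the non-simple one

Layer `Literature/Geometry/Kaehler`, namespace `Literature.Geometry.Kaehler.ComplexTorus`; lane `lit-hodgefound`
(Track 2 foundations library), Layer A2/A3 junction, row «A2-26(gh)» (self-proposed 2026-08-28, prover seat
`lit-hodgefound-p10`, generation 32, FILE 4 of the generation).  An endomorphism `u` of order `7` of a
`3`-dimensional complex torus `X` has `P_u = Φ_7` (generation 31 FILE 2: order `7` prime, `rk = 6 = φ(7)`), so
`(X, u) ≅ (ℂ^Φ/Φ(𝔞), ζ_7)` for a CM type `Φ` of `K = ℚ(ζ_7)` and an ideal class `[𝔞]` (FILE 1, Shimura's THEOREM 2),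
and `X` is an abelian threefold.  By the census of this generation (`CyclotomicCMTypeCensusSevenNine`: eight CM
types; six primitive ones forming ONE family under `Gal(ℚ(ζ_7)/ℚ)`; two imprimitive ones, `{1,2,4}` and `{3,5,6}`,
induced from `ℚ(√−7)`, forming the other) and Shimura §8.2 Prop. 26 (simple ⟺ primitive, the tree's
`isSimple_periodIso_iff_isPrimitive`):
* `X` is SIMPLE iff `Φ` is primitive; if `X` is NOT simple then `Φ` is induced from an imaginary quadratic subfield
  `K₀` and `X` is isogenous to `E × E × E`, `E = ℂ/Φ₀(𝔞₀)` a CM elliptic curve (Shimura §6.2 Thm. 3 at torus level,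
  the tree's `isIsogenous_powPeriod_periodIso_of_basis`) — for ANY sextic CM situation, §0;
* when `𝓞_{ℚ(ζ_7)}` is principal (it is: `h(ℚ(ζ_7)) = 1`, this generation's `CyclotomicFieldsSevenNineClassNumber`;
  here an instance hypothesis `[IsPrincipalIdealRing (𝓞 K)]` on the chosen model `K` of `ℚ(ζ_7)`), «same family ⟹
  same torus» (generation 31 FILE 6) gives: ALL SIMPLE `3`-TORI WITH AN AUTOMORPHISM OF ORDER `7` ARE ISOMORPHIC, ALL
  NON-SIMPLE ONES ARE ISOMORPHIC, so **`X ≅ X′ ⟺ (X simple ⟺ X′ simple)`**: EXACTLY TWO complex tori of dimension `3`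
  admit an automorphism of order `7` (both occur: `ℂ³/Φ(𝓞)` for `Φ` primitive resp. imprimitive);
* order `14` is the same story (`−u` has order `7`, generation 31 FILE 9), and since the orders of automorphisms of a
  SIMPLE `3`-torus are `1, 2, 3, 4, 6, 7, 9, 14, 18` (the tree's `IsSimple.orderOf_mem_of_card_eq_six`), a simple
  `3`-torus with an automorphism of order `7` or `14` IS the simple `ζ_7`-threefold.

WHAT IS PROVED (theorems only; no `def`, no instance, no named fact; net debt 0).
* §0 SEXTIC GENERALITIES (any number field `K` of degree `6`): `finrank_eq_two_of_ne_top_of_finrank_eq_six`,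
  **`exists_isIsogenous_cube_of_not_isSimple`** (`ℂ³/Φ(𝔞)` not simple ⟹ `∼ E³`, `E = ℂ/Φ₀(𝔞₀)` simple, `[K₀:ℚ] = 2`).
* §1 THE MODELS OF `ℚ(ζ_7)`: `finrank_eq_six_of_isCyclotomicExtension_seven`, `exists_isSimple_periodIso_seven`,
  `exists_not_isSimple_periodIso_seven`, `exists_isIsogenous_cube_periodIso_seven`,
  **`isIsomorphic_periodIso_one_iff_seven`** (`[IsPrincipalIdealRing (𝓞 K)]`:
  `ℂ³/Φ(𝓞) ≅ ℂ³/Ψ(𝓞) ⟺ (simple ⟺ simple)`).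
* §2 THE PAIRS `(X, u)`, `orderOf u = 7`, `dim X = 3`: `charpoly_eq_cyclotomic_seven_of_orderOf`,
  `isAbelianVariety_of_orderOf_eq_seven`, **`exists_isIsogenous_cube_of_orderOf_eq_seven`** (`X` not simple ⟹
  `X ∼ E × E × E`), **`isIsomorphic_of_orderOf_eq_seven_of_isSimple`**, **`isIsomorphic_of_orderOf_eq_seven_of_not_isSimple`**,
  **`isIsomorphic_iff_of_orderOf_eq_seven`** (`X ≅ X′ ⟺ (X simple ⟺ X′ simple)`), `isIsomorphic_periodIso_one_of_orderOf_eq_seven`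
  (`X ≅ ℂ³/Φ₀(𝓞)` for every `Φ₀` of the matching kind).
* §3 ORDER `14`: `orderOf_neg_eq_seven_of_orderOf_eq_fourteen`, `isIsomorphic_iff_of_orderOf_eq_seven_or_fourteen`.
* §4 SIMPLE THREEFOLDS: **`IsSimple.isIsomorphic_of_orderOf_eq_seven_or_fourteen`** (any two simple `3`-tori with
  endomorphisms of order `7` or `14` are isomorphic).

Sources.  G. Shimura, *Abelian Varieties with Complex Multiplication and Modular Functions* (1998): §6.1 Thm. 2
p. 41, §6.2 Thm. 3 pp. 42–44, §7.4 Prop. 17 p. 58, §8.2 Prop. 26 p. 69, §8.4 Example (1) p. 65 («We can similarly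
treat the case where `F` is cyclic over `Q`»; held chunk p0085).  Ch. Birkenhake, H. Lange, *Complex Abelian
Varieties*, 2nd ed. (2004), §13.3 (abelian varieties of dimension `g` with an automorphism of order `d`,
`φ(d) = 2g`; Cor. 13.3.4–13.3.6) — not held (acq-10211), locator as cited by this lane's earlier rows.  D. A. Marcus,
*Number Fields* (2018), Ch. 5 Exercise 17 (`ℤ[ζ_7]` is a PID) for the class-number input.  A. Fujiki, *Finite
automorphism groups of complex tori of dimension two*, Publ. RIMS 24 (1988) — the `2`-dimensional analogue
(generation 32 FILE 1).

## References

* [Shimura1998] G. Shimura, *Abelian Varieties with Complex Multiplication and Modular Functions*, Princeton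
  Univ. Press (1998), §6.1 Thm. 2 p. 41, §6.2 Thm. 3 pp. 42–44, §7.4 Prop. 17 p. 58, §8.2 Prop. 26 p. 69, §8.4
  Example (1) p. 65.
* [BirkenhakeLange2004] Ch. Birkenhake, H. Lange, *Complex Abelian Varieties*, 2nd ed., Grundlehren 302 (2004),
  §13.3.
* [Marcus2018] D. A. Marcus, *Number Fields*, 2nd ed. (2018), Ch. 5 Exercise 17.
* [Streng2010] M. Streng, *Complex multiplication of abelian surfaces*, PhD thesis, Leiden (2010), Ch. I Lemma 3.5.
-/

noncomputable section

open scoped Classical nonZeroDivisors NumberField Manifold ContDiff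
open NumberField Module Polynomial

namespace Literature.Geometry.Kaehler

namespace ComplexTorus

-- `open scoped`: the tree's action of `Aut(ℂ)` on `Hom(K, ℂ)` by composition (`ringEquivCompAction`) is a scoped instance
open scoped Literature.NumberTheory.ComplexMultiplication
open Literature.AlgebraicGeometry.Motives (CMType)
open Literature.NumberTheory.ComplexMultiplication (inducedCMType)
open Literature.NumberTheory.ComplexMultiplication.CMTypeLattice (periodIso isSimple_periodIso_iff_isPrimitive
  isSimple_periodIso_iff_not_exists_inducedCMType isIsogenous_powPeriod_periodIso_of_basis two_mul_card_eq_finrank)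
open Literature.NumberTheory.ComplexMultiplication (CMTypeLattice.isSimple_periodIso_of_finrank_eq_two)
open Literature.AlgebraicGeometry.ComplexMultiplication.CyclotomicCMTypeResidueSets (IsAutTransform)
open Literature.AlgebraicGeometry.ComplexMultiplication.CyclotomicCMTypeCensusSevenNine (isAutTransform_iff_seven
  ncard_isPrimitive_seven ncard_not_isPrimitive_seven)
-- `CMTypeLattice.mulMatrix I a` (multiplication by `a ∈ 𝓞 K` on the ideal `I`) is spelled with its namespace below:
-- the elliptic-curve files in the import cone declare a `ComplexTorus.mulMatrix` of their own.
open Literature.NumberTheory.ComplexMultiplication (CMTypeLattice.mulMatrix)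

/-! ### §0 Sextic generalities: a non-simple `ℂ³/Φ(𝔞)` is isogenous to the cube of a CM elliptic curve -/

section Sextic

variable {K : Type} [Field K] [NumberField K]

/-- **A proper sub-pair of a SEXTIC field is imaginary quadratic with `[K : K₀] = 3`**: if a CM type of a number field
`K` of degree `6` is induced from a CM type `Φ₀` of a proper subfield `K₀ ⊊ K`, then `[K₀ : ℚ] = 2` and `[K : K₀] = 3`
(`[K₀ : ℚ] = 2#Φ₀` is even, `[K₀ : ℚ][K : K₀] = 6`, `[K : K₀] ≠ 1`). [cite: Shimura1998, §6.2, proof of Thm. 3 («`n = mh`»), p. 42]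
[cite: Streng2010, Ch. I Lemma 3.5] -/
theorem finrank_eq_two_of_ne_top_of_finrank_eq_six (h6 : finrank ℚ K = 6) {K₀ : IntermediateField ℚ K}
    (hK₀ : K₀ ≠ ⊤) (Φ₀ : CMType K₀) : finrank ℚ K₀ = 2 ∧ finrank K₀ K = 3 := by
  have hmul : finrank ℚ K₀ * finrank K₀ K = 6 := by rw [Module.finrank_mul_finrank, h6]
  have hne : finrank K₀ K ≠ 1 := fun h1 ↦ hK₀ (IntermediateField.finrank_eq_one_iff_eq_top.1 h1)
  have h2c := two_mul_card_eq_finrank Φ₀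
  have hdvd : finrank K₀ K ∣ 6 := Dvd.intro_left _ hmul
  have hle : finrank K₀ K ≤ 6 := Nat.le_of_dvd (by norm_num) hdvd
  generalize he : finrank K₀ K = e at hmul hne hle
  interval_cases e <;> omega

/-- **A NON-SIMPLE CM torus `ℂ³/Φ(𝔞)` of a sextic field is isogenous to `E × E × E`**: `Φ` is induced from a CM
type `Φ₀` of an imaginary quadratic subfield `K₀` (Prop. 26), and `ℂ³/Φ(𝔞) ∼ (ℂ/Φ₀(𝔞₀))³` for EVERY fractional
ideal `𝔞₀` of `K₀` (Thm. 3 at torus level), the curves `ℂ/Φ₀(𝔞₀)` being simple.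
[cite: Shimura1998, §8.2 Prop. 26 p. 69 with §6.2 Thm. 3 pp. 42–44] [cite: Streng2010, Ch. I Lemma 3.5] -/
theorem exists_isIsogenous_cube_of_not_isSimple (h6 : finrank ℚ K = 6) (Φ : CMType K)
    (I : (FractionalIdeal (𝓞 K)⁰ K)ˣ) (hns : ¬ ComplexTorus.IsSimple (periodIso Φ I)) :
    ∃ (K₀ : IntermediateField ℚ K) (Φ₀ : CMType K₀),
      finrank ℚ K₀ = 2 ∧ inducedCMType (algebraMap K₀ K) Φ₀ = Φ ∧
      ∀ I₀ : (FractionalIdeal (𝓞 K₀)⁰ K₀)ˣ,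
        ComplexTorus.IsSimple (periodIso Φ₀ I₀) ∧ IsIsogenous (periodIso Φ I) (powPeriod (periodIso Φ₀ I₀) 3) := by
  rw [isSimple_periodIso_iff_not_exists_inducedCMType Φ I, not_not] at hns
  obtain ⟨K₀, Φ₀, hK₀, hΦ⟩ := hns
  obtain ⟨h2, hrel⟩ := finrank_eq_two_of_ne_top_of_finrank_eq_six h6 hK₀ Φ₀
  refine ⟨K₀, Φ₀, h2, hΦ, fun I₀ ↦ ⟨CMTypeLattice.isSimple_periodIso_of_finrank_eq_two h2 Φ₀ I₀, ?_⟩⟩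
  exact ComplexTorus.IsIsogenous.symm _ _
    (isIsogenous_powPeriod_periodIso_of_basis hΦ (Module.finBasisOfFinrankEq K₀ K hrel) I I₀)

end Sextic

/-! ### §1 The models `ℂ³/Φ(𝔞)` of `ℚ(ζ_7)`: simple iff `Φ` primitive; two isomorphism classes for `𝓞` principal -/

section Models

variable {K : Type} [Field K] [NumberField K] [IsCyclotomicExtension {7} ℚ K]

variable (K) in
/-- **`[ℚ(ζ_7) : ℚ] = φ(7) = 6`.** [cite: Shimura1998, §8.4 Example (1), p. 65] [folklore] -/
theorem finrank_eq_six_of_isCyclotomicExtension_seven : finrank ℚ K = 6 := by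
  rw [IsCyclotomicExtension.Rat.finrank 7 K]
  decide

omit [IsCyclotomicExtension {7} ℚ K] in
/-- A number field has a complex embedding (to read primitivity at). [folklore] -/
private theorem nonempty_embedding₃₂ : Nonempty (K →+* ℂ) := inferInstance

/-- **There IS a simple `ℂ³/Φ(𝔞)` for `ℚ(ζ_7)`** (six of the eight types are primitive).
[cite: Shimura1998, §8.4 Example (1) p. 65, §8.2 Prop. 26 p. 69] -/
theorem exists_isSimple_periodIso_seven (I : (FractionalIdeal (𝓞 K)⁰ K)ˣ) :
    ∃ Φ : CMType K, ComplexTorus.IsSimple (periodIso Φ I) := by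
  obtain ⟨φ₀⟩ := nonempty_embedding₃₂ (K := K)
  have hne : {Φ : CMType K | Literature.NumberTheory.ComplexMultiplication.IsPrimitive (ℂ ≃+* ℂ) Φ.1 φ₀}.Nonempty :=
    Set.nonempty_of_ncard_ne_zero (by rw [ncard_isPrimitive_seven φ₀]; norm_num)
  obtain ⟨Φ, hΦ⟩ := hne
  exact ⟨Φ, (isSimple_periodIso_iff_isPrimitive Φ I φ₀).2 hΦ⟩

/-- **There IS a non-simple `ℂ³/Φ(𝔞)` for `ℚ(ζ_7)`** (the two imprimitive types `{1,2,4}`, `{3,5,6}`).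
[cite: Shimura1998, §8.4 Example (1) p. 65, §8.2 Prop. 26 p. 69] -/
theorem exists_not_isSimple_periodIso_seven (I : (FractionalIdeal (𝓞 K)⁰ K)ˣ) :
    ∃ Φ : CMType K, ¬ ComplexTorus.IsSimple (periodIso Φ I) := by
  obtain ⟨φ₀⟩ := nonempty_embedding₃₂ (K := K)
  have hne : {Φ : CMType K | ¬ Literature.NumberTheory.ComplexMultiplication.IsPrimitive (ℂ ≃+* ℂ) Φ.1 φ₀}.Nonempty :=
    Set.nonempty_of_ncard_ne_zero (by rw [ncard_not_isPrimitive_seven φ₀]; norm_num)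
  obtain ⟨Φ, hΦ⟩ := hne
  exact ⟨Φ, fun h ↦ hΦ ((isSimple_periodIso_iff_isPrimitive Φ I φ₀).1 h)⟩

/-- **A non-simple `ℂ³/Φ(𝔞)` for `ℚ(ζ_7)` is isogenous to `E × E × E`**, `E = ℂ/Φ₀(𝔞₀)` a CM elliptic curve of the
imaginary quadratic subfield (`ℚ(√−7)`) whose type induces `Φ`, for every ideal `𝔞₀`. [cite: Shimura1998, §6.2 Thm. 3 pp. 42–44, §8.4 Example (1) p. 65] -/
theorem exists_isIsogenous_cube_periodIso_seven (Φ : CMType K) (I : (FractionalIdeal (𝓞 K)⁰ K)ˣ)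
    (hns : ¬ ComplexTorus.IsSimple (periodIso Φ I)) :
    ∃ (K₀ : IntermediateField ℚ K) (Φ₀ : CMType K₀),
      finrank ℚ K₀ = 2 ∧ inducedCMType (algebraMap K₀ K) Φ₀ = Φ ∧
      ∀ I₀ : (FractionalIdeal (𝓞 K₀)⁰ K₀)ˣ,
        ComplexTorus.IsSimple (periodIso Φ₀ I₀) ∧ IsIsogenous (periodIso Φ I) (powPeriod (periodIso Φ₀ I₀) 3) :=
  exists_isIsogenous_cube_of_not_isSimple (finrank_eq_six_of_isCyclotomicExtension_seven K) Φ I hns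

/-- **Same family ⟺ same simplicity, for `ℚ(ζ_7)`**: two CM types of `ℚ(ζ_7)` are transforms of each other by an
automorphism iff their models are both simple or both non-simple (census: the primitive types are one family, the
imprimitive ones the other). [cite: Shimura1998, §8.4 Example (1) p. 65, §8.2 Prop. 26 p. 69] -/
theorem isAutTransform_iff_isSimple_iff_seven (Φ Ψ : CMType K) (I J : (FractionalIdeal (𝓞 K)⁰ K)ˣ) :
    IsAutTransform Φ Ψ ↔ (ComplexTorus.IsSimple (periodIso Φ I) ↔ ComplexTorus.IsSimple (periodIso Ψ J)) := by
  obtain ⟨φ₀⟩ := nonempty_embedding₃₂ (K := K)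
  rw [isAutTransform_iff_seven Φ Ψ φ₀, isSimple_periodIso_iff_isPrimitive Φ I φ₀, isSimple_periodIso_iff_isPrimitive Ψ J φ₀]

variable {ζ : K} (hζ : IsPrimitiveRoot ζ 7)

include hζ in
/-- **THE MODELS `ℂ³/Φ(𝓞)` OF `ℚ(ζ_7)` ARE TWO TORI** (`𝓞` principal): `ℂ³/Φ(𝓞) ≅ ℂ³/Ψ(𝓞)` as complex tori iff both
are simple or both are not — «same family ⟹ same torus» (generation 31 FILE 6) and the census.
[cite: Shimura1998, §7.4 Prop. 17 p. 58, §8.4 Example (1) p. 65] [cite: BirkenhakeLange2004, §13.3] -/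
theorem isIsomorphic_periodIso_one_iff_seven [IsPrincipalIdealRing (𝓞 K)] (Φ Ψ : CMType K) :
    IsIsomorphic (periodIso Φ (1 : (FractionalIdeal (𝓞 K)⁰ K)ˣ)) (periodIso Ψ 1) ↔
      (ComplexTorus.IsSimple (periodIso Φ (1 : (FractionalIdeal (𝓞 K)⁰ K)ˣ)) ↔
        ComplexTorus.IsSimple (periodIso Ψ (1 : (FractionalIdeal (𝓞 K)⁰ K)ˣ))) := by
  constructor
  · intro h
    exact h.isSimple_iff
  · intro h
    obtain ⟨g, hg, hg', -⟩ :=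
      exists_iso_periodIso_one_of_isAutTransform hζ ((isAutTransform_iff_isSimple_iff_seven Φ Ψ 1 1).2 h)
    exact ⟨g, hg, hg'⟩

end Models

/-! ### §2 The pairs `(X, u)`: `3`-dimensional complex tori with an endomorphism of order `7` -/

section Seven

variable {ι : Type} [Fintype ι] [DecidableEq ι] {E : Type} [NormedAddCommGroup E] [NormedSpace ℂ E]
  {P : (ι → ℝ) ≃L[ℝ] E} {ι' : Type} [Fintype ι'] [DecidableEq ι'] {E' : Type} [NormedAddCommGroup E']
  [NormedSpace ℂ E'] {P' : (ι' → ℝ) ≃L[ℝ] E'}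

/-- `7` is prime. [folklore] -/
private theorem prime_seven₃₂ : Nat.Prime 7 := Nat.prime_seven

omit [DecidableEq ι] in
/-- **Order `7` on a `3`-dimensional complex torus forces `P_u = Φ_7`** (`rk = 6 = φ(7)`, generation 31 FILE 2).
[cite: BirkenhakeLange2004, §13.3] [cite: Lange2023AbelianVarietiesComplex, §2.4.5 Exercise (10), p0126] -/
theorem charpoly_eq_cyclotomic_seven_of_orderOf [DecidableEq ι] {A : Matrix ι ι ℤ} (hord : orderOf A = 7)
    (hdim : finrank ℂ E = 3) (P : (ι → ℝ) ≃L[ℝ] E) : A.charpoly = cyclotomic 7 ℤ :=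
  charpoly_eq_cyclotomic_of_orderOf_eq_of_finrank P prime_seven₃₂.isPrimePow hord
    (by rw [hdim, Nat.totient_prime prime_seven₃₂])

/-- **A `3`-dimensional complex torus with an endomorphism of order `7` is an abelian variety** (it is `ℂ³/Φ(𝔞)` for
`ℚ(ζ_7)`). [cite: Shimura1998, §6.2 Thm. 3, p. 42] [cite: BirkenhakeLange2004, §13.3] -/
theorem isAbelianVariety_of_orderOf_eq_seven {A : Matrix ι ι ℤ} (hA : A ∈ endRingInt P) (hord : orderOf A = 7)
    (hdim : finrank ℂ E = 3) : IsAbelianVariety P :=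
  haveI : NeZero (7 : ℕ) := ⟨by norm_num⟩
  isAbelianVariety_of_orderOf_eq hA prime_seven₃₂.isPrimePow hord (by rw [hdim, Nat.totient_prime prime_seven₃₂])

set_option backward.isDefEq.respectTransparency false in -- Mathlib's instance
-- `IsCyclotomicExtension {7} ℚ (CyclotomicField 7 ℚ)` is keyed on `CyclotomicField.algebra`, the goal on
-- `DivisionRing.toRatAlgebra` (same workaround as generation 31 FILE 1 `isAbelianVariety_of_charpoly_eq_cyclotomic`)
/-- **A NON-SIMPLE `3`-TORUS WITH AN AUTOMORPHISM OF ORDER `7` IS ISOGENOUS TO `E × E × E`**, `E = ℂ/Φ₀(𝔞₀)` a CM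
elliptic curve of an imaginary quadratic subfield `K₀ ⊂ ℚ(ζ_7)` (`= ℚ(√−7)`), for every ideal `𝔞₀` of `K₀`.
[cite: Shimura1998, §6.1 Thm. 2 p. 41, §6.2 Thm. 3 pp. 42–44, §8.2 Prop. 26 p. 69] [cite: BirkenhakeLange2004, §13.3] -/
theorem exists_isIsogenous_cube_of_orderOf_eq_seven {A : Matrix ι ι ℤ} (hA : A ∈ endRingInt P)
    (hord : orderOf A = 7) (hdim : finrank ℂ E = 3) (hns : ¬ ComplexTorus.IsSimple P) :
    ∃ (K₀ : IntermediateField ℚ (CyclotomicField 7 ℚ)) (Φ₀ : CMType K₀), finrank ℚ K₀ = 2 ∧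
      ∀ I₀ : (FractionalIdeal (𝓞 K₀)⁰ K₀)ˣ,
        ComplexTorus.IsSimple (periodIso Φ₀ I₀) ∧ IsIsogenous P (powPeriod (periodIso Φ₀ I₀) 3) := by
  have hζ := IsCyclotomicExtension.zeta_spec 7 ℚ (CyclotomicField 7 ℚ)
  obtain ⟨Φ, I, e, he, he₂, -⟩ :=
    exists_cmType_ideal_iso_of_charpoly_eq_cyclotomic hζ hA (charpoly_eq_cyclotomic_seven_of_orderOf hord hdim P)
  have hns' : ¬ ComplexTorus.IsSimple (periodIso Φ I) := fun h ↦ hns ((IsIsomorphic.isSimple_iff ⟨e, he, he₂⟩).2 h)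
  obtain ⟨K₀, Φ₀, h2, -, hI⟩ := exists_isIsogenous_cube_periodIso_seven Φ I hns'
  exact ⟨K₀, Φ₀, h2, fun I₀ ↦ ⟨(hI I₀).1,
    IsIsogenous.trans _ _ _ (IsIsomorphic.isIsogenous ⟨e, he, he₂⟩) (hI I₀).2⟩⟩

variable (K : Type) [Field K] [NumberField K] [IsCyclotomicExtension {7} ℚ K]

/-- **ALL SIMPLE `3`-DIMENSIONAL COMPLEX TORI WITH AN ENDOMORPHISM OF ORDER `7` ARE ISOMORPHIC** (read through any
model `K` of `ℚ(ζ_7)` with `𝓞_K` principal — `h(ℚ(ζ_7)) = 1`): both are `ℂ³/Φ(𝓞)`, `ℂ³/Φ′(𝓞)` with `Φ, Φ′` PRIMITIVE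
(simple ⟺ primitive), and the primitive types of `ℚ(ζ_7)` form ONE family, so «same family ⟹ same torus».
[cite: Shimura1998, §7.4 Prop. 17 p. 58, §8.2 Prop. 26 p. 69, §8.4 Example (1) p. 65] [cite: BirkenhakeLange2004, §13.3] -/
theorem isIsomorphic_of_orderOf_eq_seven_of_isSimple [IsPrincipalIdealRing (𝓞 K)] (hX : ComplexTorus.IsSimple P)
    {A : Matrix ι ι ℤ} (hA : A ∈ endRingInt P) (hord : orderOf A = 7) (hdim : finrank ℂ E = 3)
    (hX' : ComplexTorus.IsSimple P') {A' : Matrix ι' ι' ℤ} (hA' : A' ∈ endRingInt P') (hord' : orderOf A' = 7)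
    (hdim' : finrank ℂ E' = 3) : IsIsomorphic P P' := by
  obtain ⟨ζ, hζ⟩ : ∃ ζ : K, IsPrimitiveRoot ζ 7 :=
    IsCyclotomicExtension.exists_isPrimitiveRoot ℚ K (Set.mem_singleton 7) (by norm_num)
  have hP := charpoly_eq_cyclotomic_seven_of_orderOf hord hdim P
  have hP' := charpoly_eq_cyclotomic_seven_of_orderOf hord' hdim' P'
  obtain ⟨Φ, I, e, he, he₂, hcomm⟩ := exists_cmType_ideal_iso_of_charpoly_eq_cyclotomic hζ hA hP
  obtain ⟨Φ', I', e', he', he₂', hcomm'⟩ := exists_cmType_ideal_iso_of_charpoly_eq_cyclotomic hζ hA' hP'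
  have hS : ComplexTorus.IsSimple (periodIso Φ I) := (IsIsomorphic.isSimple_iff ⟨e, he, he₂⟩).1 hX
  have hS' : ComplexTorus.IsSimple (periodIso Φ' I') := (IsIsomorphic.isSimple_iff ⟨e', he', he₂'⟩).1 hX'
  have hfam : IsAutTransform Φ Φ' := (isAutTransform_iff_isSimple_iff_seven Φ Φ' I I').2 (iff_of_true hS hS')
  exact isIsomorphic_of_isAutTransform hζ hA hP hA' hP' e he hcomm e' he' he₂' hcomm' hfam

/-- **ALL NON-SIMPLE `3`-DIMENSIONAL COMPLEX TORI WITH AN ENDOMORPHISM OF ORDER `7` ARE ISOMORPHIC** (`𝓞_{ℚ(ζ_7)}`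
principal): their types are the two IMPRIMITIVE ones, which form one family. [cite: Shimura1998, §7.4 Prop. 17 p. 58, §8.2 Prop. 26 p. 69, §8.4 Example (1) p. 65]
[cite: BirkenhakeLange2004, §13.3] -/
theorem isIsomorphic_of_orderOf_eq_seven_of_not_isSimple [IsPrincipalIdealRing (𝓞 K)]
    (hX : ¬ ComplexTorus.IsSimple P) {A : Matrix ι ι ℤ} (hA : A ∈ endRingInt P) (hord : orderOf A = 7)
    (hdim : finrank ℂ E = 3) (hX' : ¬ ComplexTorus.IsSimple P') {A' : Matrix ι' ι' ℤ} (hA' : A' ∈ endRingInt P')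
    (hord' : orderOf A' = 7) (hdim' : finrank ℂ E' = 3) : IsIsomorphic P P' := by
  obtain ⟨ζ, hζ⟩ : ∃ ζ : K, IsPrimitiveRoot ζ 7 :=
    IsCyclotomicExtension.exists_isPrimitiveRoot ℚ K (Set.mem_singleton 7) (by norm_num)
  have hP := charpoly_eq_cyclotomic_seven_of_orderOf hord hdim P
  have hP' := charpoly_eq_cyclotomic_seven_of_orderOf hord' hdim' P'
  obtain ⟨Φ, I, e, he, he₂, hcomm⟩ := exists_cmType_ideal_iso_of_charpoly_eq_cyclotomic hζ hA hP
  obtain ⟨Φ', I', e', he', he₂', hcomm'⟩ := exists_cmType_ideal_iso_of_charpoly_eq_cyclotomic hζ hA' hP'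
  have hS : ¬ ComplexTorus.IsSimple (periodIso Φ I) := fun h ↦ hX ((IsIsomorphic.isSimple_iff ⟨e, he, he₂⟩).2 h)
  have hS' : ¬ ComplexTorus.IsSimple (periodIso Φ' I') := fun h ↦ hX' ((IsIsomorphic.isSimple_iff ⟨e', he', he₂'⟩).2 h)
  have hfam : IsAutTransform Φ Φ' := (isAutTransform_iff_isSimple_iff_seven Φ Φ' I I').2 (iff_of_false hS hS')
  exact isIsomorphic_of_isAutTransform hζ hA hP hA' hP' e he hcomm e' he' he₂' hcomm' hfam

/-- **EXACTLY TWO COMPLEX TORI OF DIMENSION `3` ADMIT AN AUTOMORPHISM OF ORDER `7`** (`𝓞_{ℚ(ζ_7)}` principal): two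
`3`-dimensional complex tori `X`, `X′` carrying endomorphisms of order `7` are isomorphic iff both are simple or both
are not. [cite: Shimura1998, §7.4 Prop. 17 p. 58, §8.2 Prop. 26 p. 69, §8.4 Example (1) p. 65] [cite: BirkenhakeLange2004, §13.3] -/
theorem isIsomorphic_iff_of_orderOf_eq_seven [IsPrincipalIdealRing (𝓞 K)] {A : Matrix ι ι ℤ}
    (hA : A ∈ endRingInt P) (hord : orderOf A = 7) (hdim : finrank ℂ E = 3) {A' : Matrix ι' ι' ℤ}
    (hA' : A' ∈ endRingInt P') (hord' : orderOf A' = 7) (hdim' : finrank ℂ E' = 3) :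
    IsIsomorphic P P' ↔ (ComplexTorus.IsSimple P ↔ ComplexTorus.IsSimple P') := by
  refine ⟨fun h ↦ h.isSimple_iff, fun h ↦ ?_⟩
  by_cases hX : ComplexTorus.IsSimple P
  · exact isIsomorphic_of_orderOf_eq_seven_of_isSimple K hX hA hord hdim (h.1 hX) hA' hord' hdim'
  · exact isIsomorphic_of_orderOf_eq_seven_of_not_isSimple K hX hA hord hdim (fun h' ↦ hX (h.2 h')) hA' hord' hdim'

variable {K}

/-- `dim_ℂ ℂ^Φ = 3` for a CM type `Φ` of `ℚ(ζ_7)` (`2 dim = φ(7) = 6`). [cite: Shimura1998, §6.2 Thm. 3, p. 42] -/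
private theorem finrank_pi_cmType_seven (Φ : CMType K) : finrank ℂ (Φ.1 → ℂ) = 3 := by
  have h := two_mul_finrank_pi_cmType (d := 7) (K := K) Φ
  rw [Nat.totient_prime prime_seven₃₂] at h
  omega

variable (K) in
/-- **`X ≅ ℂ³/Φ₀(𝓞_{ℚ(ζ_7)})` for EVERY type `Φ₀` of the matching kind** (`𝓞` principal): a `3`-torus `X` with an
endomorphism of order `7` is isomorphic to the model `ℂ³/Φ₀(𝓞)` as soon as `X` and the model are both simple or both
non-simple — not only to the model of its own type. [cite: Shimura1998, §7.4 Prop. 17 p. 58, §8.4 Example (1) p. 65]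
[cite: BirkenhakeLange2004, §13.3] -/
theorem isIsomorphic_periodIso_one_of_orderOf_eq_seven [IsPrincipalIdealRing (𝓞 K)] {ζ : K}
    (hζ : IsPrimitiveRoot ζ 7) (Φ₀ : CMType K) {A : Matrix ι ι ℤ} (hA : A ∈ endRingInt P) (hord : orderOf A = 7)
    (hdim : finrank ℂ E = 3)
    (h : ComplexTorus.IsSimple P ↔ ComplexTorus.IsSimple (periodIso Φ₀ (1 : (FractionalIdeal (𝓞 K)⁰ K)ˣ))) :
    IsIsomorphic P (periodIso Φ₀ (1 : (FractionalIdeal (𝓞 K)⁰ K)ˣ)) :=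
  (isIsomorphic_iff_of_orderOf_eq_seven K hA hord hdim (mulMatrix_toInteger_mem_endRingInt hζ Φ₀ 1)
    (orderOf_mulMatrix_toInteger hζ Φ₀ 1) (finrank_pi_cmType_seven Φ₀)).2 h

/-! ### §3 Order `14`: `−u` has order `7` -/

/-- **An endomorphism of order `14` of a `3`-dimensional complex torus has `−u` of order `7`** (generation 31
FILE 9: `P_u = Φ_14` is forced in rank `6 = φ(14)`, and `−ζ_14` is a primitive `7`-th root of unity).
[cite: BirkenhakeLange2004, §13.3] [cite: BambergCairnsKilminster2003, Thm. 1] -/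
theorem orderOf_neg_eq_seven_of_orderOf_eq_fourteen {A : Matrix ι ι ℤ} (hA : A ∈ endRingInt P)
    (hord : orderOf A = 14) (hdim : finrank ℂ E = 3) : orderOf (-A) = 7 := by
  have h := orderOf_neg_of_orderOf_eq_two_mul_prime_pow prime_seven₃₂ (by norm_num) 0 hA
    (by rw [zero_add, pow_one]; exact hord) (by rw [zero_add, pow_one, hdim, Nat.totient_prime prime_seven₃₂])
  rwa [zero_add, pow_one] at h

/-- An endomorphism of order `7` or `14` of a `3`-torus yields one of order `7` (`u` itself or `−u`).
[cite: BirkenhakeLange2004, §13.3] -/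
theorem exists_orderOf_eq_seven_of_orderOf_eq_seven_or_fourteen {A : Matrix ι ι ℤ} (hA : A ∈ endRingInt P)
    (hord : orderOf A = 7 ∨ orderOf A = 14) (hdim : finrank ℂ E = 3) :
    ∃ B : Matrix ι ι ℤ, B ∈ endRingInt P ∧ orderOf B = 7 := by
  rcases hord with h | h
  · exact ⟨A, hA, h⟩
  · exact ⟨-A, Subring.neg_mem _ hA, orderOf_neg_eq_seven_of_orderOf_eq_fourteen hA h hdim⟩

/-- **The classification for orders `7` and `14` together** (`𝓞_{ℚ(ζ_7)}` principal): two `3`-dimensional complex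
tori carrying endomorphisms of order `7` or `14` are isomorphic iff both are simple or both are not.
[cite: Shimura1998, §7.4 Prop. 17 p. 58, §8.4 Example (1) p. 65] [cite: BirkenhakeLange2004, §13.3] -/
theorem isIsomorphic_iff_of_orderOf_eq_seven_or_fourteen [IsPrincipalIdealRing (𝓞 K)] {A : Matrix ι ι ℤ}
    (hA : A ∈ endRingInt P) (hord : orderOf A = 7 ∨ orderOf A = 14) (hdim : finrank ℂ E = 3) {A' : Matrix ι' ι' ℤ}
    (hA' : A' ∈ endRingInt P') (hord' : orderOf A' = 7 ∨ orderOf A' = 14) (hdim' : finrank ℂ E' = 3) :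
    IsIsomorphic P P' ↔ (ComplexTorus.IsSimple P ↔ ComplexTorus.IsSimple P') := by
  obtain ⟨B, hB, hB7⟩ := exists_orderOf_eq_seven_of_orderOf_eq_seven_or_fourteen hA hord hdim
  obtain ⟨B', hB', hB7'⟩ := exists_orderOf_eq_seven_of_orderOf_eq_seven_or_fourteen hA' hord' hdim'
  exact isIsomorphic_iff_of_orderOf_eq_seven K hB hB7 hdim hB' hB7' hdim'

/-! ### §4 Simple threefolds: one torus for the orders `7` and `14` -/

/-- **A SIMPLE `3`-DIMENSIONAL COMPLEX TORUS WITH AN AUTOMORPHISM OF ORDER `7` OR `14` IS THE SIMPLE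
`ζ_7`-THREEFOLD**: any two simple `3`-tori carrying endomorphisms of order `7` or `14` are isomorphic (`𝓞_{ℚ(ζ_7)}`
principal).  The orders met on simple `3`-tori are `1, 2, 3, 4, 6, 7, 9, 14, 18` (the tree's
`IsSimple.orderOf_mem_of_card_eq_six`). [cite: Shimura1998, §7.4 Prop. 17 p. 58, §8.2 Prop. 26 p. 69, §8.4 Example (1) p. 65]
[cite: BirkenhakeLange2004, §13.3] -/
theorem IsSimple.isIsomorphic_of_orderOf_eq_seven_or_fourteen [IsPrincipalIdealRing (𝓞 K)]
    (hX : ComplexTorus.IsSimple P) {A : Matrix ι ι ℤ} (hA : A ∈ endRingInt P) (hord : orderOf A = 7 ∨ orderOf A = 14)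
    (hdim : finrank ℂ E = 3) (hX' : ComplexTorus.IsSimple P') {A' : Matrix ι' ι' ℤ} (hA' : A' ∈ endRingInt P')
    (hord' : orderOf A' = 7 ∨ orderOf A' = 14) (hdim' : finrank ℂ E' = 3) : IsIsomorphic P P' :=
  (ComplexTorus.isIsomorphic_iff_of_orderOf_eq_seven_or_fourteen (K := K) hA hord hdim hA' hord' hdim').2
    (iff_of_true hX hX')

end Seven

end ComplexTorus

end Literature.Geometry.Kaehler

end
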